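import Literature.Probability.LatticeModels.PlusStateHeatBath
import Literature.Analysis.FluidPDE.ElgindiTransportL2Coercivity
import Summits.CriticalPhenomena.Ising3DConformalLimit.Theorems.SubPtolemyInterlacingSubPtolemyFloorSteinCovariance
import HarnessLib

/-!
# Cauchy–Schwarz in the plus state `⟨f g⟩² ≤ ⟨f²⟩ ⟨g²⟩`

Stub `stub_plusCauchySchwarz` of the line `Sketch` (idea `stein-cramer-rao-dual-witness`) for the
crux `SubPtolemyFloor` (stmt-CriticalPhenomena-15703, route decl
`Summit.CriticalPhenomena.Ising3DConformalLimit.Theses.SubPtolemyInterlacing.SubPtolemyFloor`).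

Notation: `β ≥ 0`, `⟨·⟩ = plusExpect d β 0` (the plus state of the nearest-neighbour Ising model on
`ℤ^d` at zero field). For LOCAL observables `f`, `g` (functions of the spins in finite sets `D₁`,
`D₂`) the plus state is a genuine integral against the plus Gibbs measure `μ⁺`
(`exists_plusMeasure_integral_eq_plusExpect`): the three observables `f g`, `f²`, `g²` are local
(they read `D₁ ∪ D₂`, `D₁`, `D₂`), hence bounded and integrable
(`integrable_of_dependsOn_finset`), and the claim is the Cauchy–Schwarz inequality
`(∫ f g dμ⁺)² ≤ (∫ f² dμ⁺) (∫ g² dμ⁺)` in its square-root-free form (tree lemma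
`Literature.Analysis.FluidPDE.Elgindi.sq_integral_mul_le`, from `0 ≤ ∫ (s f − t g)² dμ⁺` for all
real `s`, `t`). In the skeleton this feeds the Cramér–Rao floor (`f` = block spin, `g` = Stein sum).
-/

noncomputable section

namespace Summit.CriticalPhenomena.Ising3DConformalLimit.SubPtolemyFloorStein

open Finset MeasureTheory Literature.Probability.LatticeModels

/-! ### Locality of squares -/

/-- The square of a local observable is local (it reads the same support). [folklore] -/
theorem cs_dependsOn_sq {d : ℕ} {F : SpinConfig (Site d) → ℝ} {D : Finset (Site d)}
    (hF : DependsOn F (↑D : Set (Site d))) :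
    DependsOn (fun σ : SpinConfig (Site d) => F σ ^ 2) (↑D : Set (Site d)) :=
  fun σ τ hst => by
    dsimp only
    rw [hF hst]

/-! ### The stub -/

/-- **Cauchy–Schwarz in the plus state** for local observables: for `β ≥ 0` and `f`, `g` depending
on the spins in finite sets `D₁`, `D₂`,
`⟨f g⟩⁺_{β,0}² ≤ ⟨f²⟩⁺_{β,0} · ⟨g²⟩⁺_{β,0}`. The plus state integrates the local observables
`f g`, `f²`, `g²` against the plus Gibbs measure (`exists_plusMeasure_integral_eq_plusExpect`),
where they are integrable (`integrable_of_dependsOn_finset`), and Cauchy–Schwarz for integrals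
(`Literature.Analysis.FluidPDE.Elgindi.sq_integral_mul_le`) concludes. [folklore] -/
theorem stub_plusCauchySchwarz :
    ∀ (d : ℕ) (β : ℝ), 0 ≤ β → ∀ (D₁ D₂ : Finset (Site d)) (f g : SpinConfig (Site d) → ℝ),
      DependsOn f (↑D₁ : Set (Site d)) → DependsOn g (↑D₂ : Set (Site d)) →
        plusExpect d β 0 (fun σ => f σ * g σ) ^ 2 ≤
          plusExpect d β 0 (fun σ => f σ ^ 2) * plusExpect d β 0 (fun σ => g σ ^ 2) := by
  intro d β hβ D₁ D₂ f g hf hg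
  obtain ⟨μ, _, -, -, -, hμE⟩ := exists_plusMeasure_integral_eq_plusExpect (d := d) hβ 0
  have hfg := cov_dependsOn_mul hf hg
  have hf2 := cs_dependsOn_sq hf
  have hg2 := cs_dependsOn_sq hg
  rw [hμE _ _ hfg, hμE _ _ hf2, hμE _ _ hg2]
  exact Literature.Analysis.FluidPDE.Elgindi.sq_integral_mul_le
    (integrable_of_dependsOn_finset μ _ hf2) (integrable_of_dependsOn_finset μ _ hg2)
    (integrable_of_dependsOn_finset μ _ hfg)

end Summit.CriticalPhenomena.Ising3DConformalLimit.SubPtolemyFloorStein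

end
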